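import Mathlib
import Summits.NavierStokesRegularity.NavierStokesRegularity.Theorems.LerayQuarterDissipationFiniteDissipationLiouvilleVorticityLThreeTools
import HarnessLib

/-!
# Crux `FiniteDissipationLiouville` (stmt-NavierStokesRegularity-22144): the `L⁶`-VELOCITY
# parameter of the finite-dissipation stratum — tools (scale invariance of the `L⁶` law, the
# weighted quartic Young endgame, coefficient bookkeeping) — `L⁶`-velocity threshold, file 1/3

Theorems file of route `LerayQuarterDissipation` (lead prover g16; `--supports` the crux; tools for
`…VelocityLSixStretching` / `…VelocityLSix`). Navier–Stokes regularity is NOT proved by anything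
here; no summit is.
`U = lerayOrbit V`, `Ω = lerayVorticity V = curl U`, `φ_R(y) = smoothTransition(2 − ‖y‖²/R²)`,
`Z_R = ∫φ_R²‖Ω‖²`, `D_R = ∫φ_R²|∇Ω|²_F`, `I = ∫_{B̄_{2R}}‖Ω‖²`, `KS = SNormLESNormFDerivOfEqConst ℝ³ volume 2`
(Mathlib's Gagliardo–Nirenberg–Sobolev constant). A FIFTH scale-invariant parameter of the stratum:
the `L⁶`-VELOCITY constant `V₆ = sup_t (−t)^{1/4}‖V(t)‖_{L⁶}` = `sup_s ‖U(s)‖_{L⁶}` (finite on the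
stratum: `…SliceLSix.memLp_six_slice`; by Sobolev `V₆ ≤ KS·√K`, so `KS²V₆⁴ ≤ KS⁶K² = θ(K)⁴`).

* `integrable_pow_norm_of_lintegral_lt_top`, `ofReal_integral_pow_norm` — powers of norms, Bochner
  versus lower Lebesgue integral;
* `integrable_pow_six_norm_lerayOrbit_of_law` — scale invariance of the `L⁶`-velocity law:
  `∫⁻‖V(t)‖ₑ⁶ ≤ w⁶/(√(−t))³` for all `t < 0` gives `∫‖U(s)‖⁶ ≤ w⁶` for all `s`;
* `two_mul_le_of_le_mul_mul_cube` — the weighted quartic Young endgame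
  `S ≤ θab³ ⇒ 2S ≤ (27θ⁴/(128η³))a⁴ + 2ηb⁴`;
* (file 2/3 `…VelocityLSixStretching`: `two_mul_integral_sqCutoff_stretching_le_lsix` — if `∫‖U(s)‖⁶ ≤ w⁶` then for `R ≥ 1`, `δ > 0`:
  `2∫φ_R²⟪DUΩ,Ω⟫ ≤ 2D_R + ((27/128)(1+δ)KS²w⁴)·Z_R + 0·Z_∞ + ((2c₁²/δ + 4Cc₁)/R)·I` — move the
  derivative onto `Ω` (`integral_mul_inner_stretching_eq`), Cauchy–Schwarz
  `∫φ²|U|‖DΩ‖‖Ω‖ ≤ ‖φ|U|‖Ω‖‖₂ √D_R`, Hölder `(3, 3/2)`: `∫|U|²φ²‖Ω‖² ≤ ‖U‖₆²‖φΩ‖₃²`, the `L³`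
  Gagliardo–Nirenberg inequality `‖φΩ‖₃² ≤ KS‖φΩ‖₂‖D(φΩ)‖₂`
  (`Literature.Analysis.FluidPDE.integral_norm_pow_three_le_of_integrable`), the weighted product
  rule, and Young `4ab³ ≤ a⁴ + 3b⁴` with the weight that makes the dissipation cancel EXACTLY; this is
  lead g14's sharper Ladyzhenskaya chain (`…SmallDissipationGapSharperStretching`, `θ = √K·KS^{3/2}`)
  with `√K·KS` REPLACED BY `‖U‖₆`: the dissipation constant enters that chain only through Sobolev.

HONEST FRAMING. One estimate about a HYPOTHETICAL class with Mathlib's (non-sharp) Sobolev constant;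
nothing here bears on Navier–Stokes regularity or blow-up; nothing is removed from the catalogued DSS
wall. References: Ladyzhenskaya 1969 §1.1; Evans 2010 §5.6.1; folklore energy method.
-/

noncomputable section

set_option linter.dupNamespace false

namespace Summit.NavierStokesRegularity.NavierStokesRegularity.Theorems.FiniteDissipationLiouville.VelocityLSix

open MeasureTheory Set Filter Topology Metric InnerProductSpace Function Real
open scoped RealInnerProductSpace ContDiff ENNReal Laplacian
open Literature.Analysis Literature.Analysis.FluidPDE
open Summit.NavierStokesRegularity.NavierStokesRegularity.Theorems
open Summit.NavierStokesRegularity.NavierStokesRegularity.Theorems.GaussianGap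
open Summit.NavierStokesRegularity.NavierStokesRegularity.Theorems.SimilarityEnstrophy
open Summit.NavierStokesRegularity.NavierStokesRegularity.Theorems.SmallDissipationGap
open Summit.NavierStokesRegularity.NavierStokesRegularity.Theorems.FiniteDissipationLiouville.VorticityAmplitude
open Summit.NavierStokesRegularity.NavierStokesRegularity.Theorems.FiniteDissipationLiouville.VorticityLThree

variable {C : ℝ} {V : ℝ → (EuclideanSpace ℝ (Fin 3)) → (EuclideanSpace ℝ (Fin 3))}

/-! ### Powers of norms: Bochner versus lower Lebesgue integral -/

section Powers

/-- A continuous field with `∫⁻ ‖f‖ₑⁿ < ∞` has integrable `‖f‖ⁿ`. [folklore] -/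
theorem integrable_pow_norm_of_lintegral_lt_top {f : EuclideanSpace ℝ (Fin 3) → EuclideanSpace ℝ (Fin 3)}
    (hf : Continuous f) (n : ℕ) (h : ∫⁻ x, ‖f x‖ₑ ^ n < ⊤) : Integrable fun x => ‖f x‖ ^ n := by
  refine ⟨(hf.norm.pow n).aestronglyMeasurable, ?_⟩
  refine (hasFiniteIntegral_iff_enorm).2 (lt_of_le_of_lt (le_of_eq ?_) h)
  refine lintegral_congr fun x => ?_
  rw [Real.enorm_eq_ofReal (pow_nonneg (norm_nonneg _) n), ← ofReal_norm,
    ENNReal.ofReal_pow (norm_nonneg _)]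

/-- `ofReal (∫ ‖f‖ⁿ) = ∫⁻ ‖f‖ₑⁿ` for integrable `‖f‖ⁿ`. [folklore] -/
theorem ofReal_integral_pow_norm {f : EuclideanSpace ℝ (Fin 3) → EuclideanSpace ℝ (Fin 3)} (n : ℕ)
    (hf : Integrable fun x => ‖f x‖ ^ n) :
    ENNReal.ofReal (∫ x, ‖f x‖ ^ n) = ∫⁻ x, ‖f x‖ₑ ^ n := by
  rw [ofReal_integral_eq_lintegral_ofReal hf (ae_of_all _ fun x => pow_nonneg (norm_nonneg _) n)]
  refine lintegral_congr fun x => ?_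
  rw [← ofReal_norm, ENNReal.ofReal_pow (norm_nonneg _)]

end Powers

/-! ### Scale invariance of the `L⁶`-velocity law -/

section Scaling

/-- **Scale invariance of the `L⁶`-velocity law.** If `∫⁻ ‖V(t)‖ₑ⁶ ≤ w⁶/(√(−t))³` for all `t < 0`
(i.e. `(−t)^{1/4}‖V(t)‖_{L⁶} ≤ w`, `w ≥ 0`), then every similarity slice `U(s) = lerayOrbit V s` has
`‖U(s)‖⁶ ∈ L¹` with `∫‖U(s)‖⁶ ≤ w⁶`: `U(s)(y) = e^{−s/2} V(t)(e^{−s/2}y)`, `t = −e^{−s}`, and the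
substitution costs `e^{3s/2}`. [folklore; Leray 1934 §20 (scaling)] -/
theorem integrable_pow_six_norm_lerayOrbit_of_law (hV : IsTypeIAncientMild C V) {w : ℝ}
    (hu : ∀ t : ℝ, t < 0 → ∫⁻ x, ‖V t x‖ₑ ^ 6 ≤ ENNReal.ofReal (w ^ 6 / Real.sqrt (-t) ^ 3))
    (s : ℝ) :
    Integrable (fun y => ‖lerayOrbit V s y‖ ^ 6) ∧ ∫ y, ‖lerayOrbit V s y‖ ^ 6 ≤ w ^ 6 := by
  set t : ℝ := -Real.exp (-s) with htdef
  set c : ℝ := Real.exp (-s / 2) with hcdef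
  have ht : t < 0 := neg_neg_of_pos (Real.exp_pos _)
  have hc : 0 < c := Real.exp_pos _
  have hsqrt : Real.sqrt (-t) = c := by rw [htdef, neg_neg, sqrt_exp_neg]
  have hcont : Continuous (V t) := (hV.contDiff_slice ht).continuous
  have hbd : ∫⁻ x, ‖V t x‖ₑ ^ 6 ≤ ENNReal.ofReal (w ^ 6 / c ^ 3) := by rw [← hsqrt]; exact hu t ht
  have hintV : Integrable fun x => ‖V t x‖ ^ 6 :=
    integrable_pow_norm_of_lintegral_lt_top hcont 6 (lt_of_le_of_lt hbd ENNReal.ofReal_lt_top)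
  have hvalV : ∫ x, ‖V t x‖ ^ 6 ≤ w ^ 6 / c ^ 3 := by
    refine (ENNReal.ofReal_le_ofReal_iff (by positivity)).1 ?_
    rw [ofReal_integral_pow_norm 6 hintV]
    exact hbd
  have hrepr : ∀ y, ‖lerayOrbit V s y‖ ^ 6 = c ^ 6 * ‖V t (c • y)‖ ^ 6 := by
    intro y
    rw [lerayOrbit_apply, norm_smul, Real.norm_of_nonneg hc.le, mul_pow]
  have hfun : (fun y => ‖lerayOrbit V s y‖ ^ 6) =
      fun y => c ^ 6 * (fun x => ‖V t x‖ ^ 6) (c • y) := funext hrepr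
  have hintc : Integrable fun y => (fun x => ‖V t x‖ ^ 6) (c • y) :=
    (integrable_comp_smul_iff (volume : Measure (EuclideanSpace ℝ (Fin 3)))
      (fun x => ‖V t x‖ ^ 6) hc.ne').2 hintV
  refine ⟨by rw [hfun]; exact hintc.const_mul _, ?_⟩
  have hsc : (∫ y, (fun x => ‖V t x‖ ^ 6) (c • y)) = |(c ^ 3)⁻¹| • ∫ x, ‖V t x‖ ^ 6 := by
    have h := Measure.integral_comp_smul (volume : Measure (EuclideanSpace ℝ (Fin 3)))
      (fun x => ‖V t x‖ ^ 6) c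
    rw [finrank_euclideanSpace_fin] at h
    exact h
  rw [hfun, integral_const_mul, hsc, smul_eq_mul, abs_of_nonneg (by positivity)]
  have hc3 : c ^ 6 * (c ^ 3)⁻¹ = c ^ 3 := by field_simp
  calc c ^ 6 * ((c ^ 3)⁻¹ * ∫ x, ‖V t x‖ ^ 6) = c ^ 3 * ∫ x, ‖V t x‖ ^ 6 := by
        rw [← mul_assoc, hc3]
    _ ≤ c ^ 3 * (w ^ 6 / c ^ 3) := mul_le_mul_of_nonneg_left hvalV (pow_nonneg hc.le 3)
    _ = w ^ 6 := by field_simp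

end Scaling

/-! ### The weighted quartic Young endgame -/

section Scalar

/-- **Weighted quartic Young inequality.** From `S ≤ θ·a·b³` with `θ, a, b ≥ 0` and a weight
`η > 0`: `2S ≤ (27θ⁴/(128η³))·a⁴ + 2η·b⁴` (`4(θm³a)(b/m)³ ≤ (θm³a)⁴ + 3(b/m)⁴` with `m⁴ = 3/(4η)`).
[folklore] -/
theorem two_mul_le_of_le_mul_mul_cube {S θ a b η : ℝ} (hS : S ≤ θ * a * b ^ 3) (hθ : 0 ≤ θ)
    (ha : 0 ≤ a) (hb : 0 ≤ b) (hη : 0 < η) :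
    2 * S ≤ 27 * θ ^ 4 / (128 * η ^ 3) * a ^ 4 + 2 * η * b ^ 4 := by
  -- `m = (3/(4η))^{1/4}` realised through `μ = m⁴`
  set μ : ℝ := 3 / (4 * η) with hμdef
  have hμ : 0 < μ := by positivity
  set m : ℝ := Real.sqrt (Real.sqrt μ) with hmdef
  have hm2 : m ^ 2 = Real.sqrt μ := Real.sq_sqrt (Real.sqrt_nonneg μ)
  have hm4 : m ^ 4 = μ := by rw [show m ^ 4 = (m ^ 2) ^ 2 by ring, hm2, Real.sq_sqrt hμ.le]
  have hm : 0 < m := Real.sqrt_pos.2 (Real.sqrt_pos.2 hμ)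
  have hY := four_mul_mul_cube_le (a := θ * m ^ 3 * a) (b := b / m) (by positivity) (by positivity)
  have e1 : 4 * (θ * m ^ 3 * a * (b / m) ^ 3) = 4 * (θ * a * b ^ 3) := by
    field_simp
  have e2 : (θ * m ^ 3 * a) ^ 4 + 3 * (b / m) ^ 4 = θ ^ 4 * m ^ 12 * a ^ 4 + 3 * b ^ 4 / m ^ 4 := by
    field_simp
  rw [e1, e2, hm4, show m ^ 12 = (m ^ 4) ^ 3 by ring, hm4] at hY
  have e3 : θ ^ 4 * μ ^ 3 * a ^ 4 + 3 * b ^ 4 / μ = 2 * (27 * θ ^ 4 / (128 * η ^ 3) * a ^ 4 + 2 * η * b ^ 4) := by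
    rw [hμdef]
    field_simp
    ring
  rw [e3] at hY
  linarith

/-- Coefficient bookkeeping for the `L⁶`-priced stretching bound (the `Z_R` coefficient): with
`θ = w√KS/√(1+δ)` and `η = 1/(1+δ)`, `27θ⁴/(128η³) = (27/128)(1+δ)KS²w⁴`. [folklore] -/
theorem coef_enstrophy_eq {δ KS : ℝ} (hδ : 0 < δ) (hKS : 0 ≤ KS) (w : ℝ) :
    27 * (w * Real.sqrt KS / Real.sqrt (1 + δ)) ^ 4 / (128 * (1 / (1 + δ)) ^ 3) =
      27 / 128 * (1 + δ) * KS ^ 2 * w ^ 4 := by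
  have hδ1 : 0 < 1 + δ := by linarith
  have h4 : (w * Real.sqrt KS / Real.sqrt (1 + δ)) ^ 4 = w ^ 4 * KS ^ 2 / (1 + δ) ^ 2 := by
    rw [div_pow, mul_pow, show Real.sqrt KS ^ 4 = (Real.sqrt KS ^ 2) ^ 2 by ring, Real.sq_sqrt hKS,
      show Real.sqrt (1 + δ) ^ 4 = (Real.sqrt (1 + δ) ^ 2) ^ 2 by ring, Real.sq_sqrt hδ1.le]
  rw [h4]
  field_simp

/-- Coefficient bookkeeping (the dissipation side): with `η = 1/(1+δ)`,
`2η((1+δ)D + (1+δ⁻¹)J) = 2D + (2/δ)J`. [folklore] -/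
theorem coef_dissipation_eq {δ : ℝ} (hδ : 0 < δ) (D J : ℝ) :
    2 * (1 / (1 + δ)) * ((1 + δ) * D + (1 + δ⁻¹) * J) = 2 * D + 2 / δ * J := by
  have hδ1 : (1 + δ) ≠ 0 := by positivity
  have hδ0 : δ ≠ 0 := hδ.ne'
  field_simp
  ring

end Scalar

end Summit.NavierStokesRegularity.NavierStokesRegularity.Theorems.FiniteDissipationLiouville.VelocityLSix

end
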